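import Summits.QuantumFields.YangMills.Theorems.UnitScaleTiltFluctuationComparisonRegPrGlobalSlackCanonicalPolymersCoreRowsV4
import Summits.QuantumFields.YangMills.Theorems.UnitScaleTiltFluctuationComparisonRegPrGlobalSlackCanonicalPolymersTermSizeC
import HarnessLib

/-!
# `UnitScaleTiltFluctuationComparisonRegPrGlobalSlackCanonicalPolymersCoreSizesV4` — THE v4 TWIN (★★OWNER RULING g26-№14 (F-2b); P22b trunk 3, width seat ym-ust-20520-w2 g4; skeleton v5kD) of `…CoreSizes`: PRODUCER ROW 5 (THE SIZE ROW (44) AT THE TRIVIAL HISTORY) FOR THE CANONICAL POLYMERISATION OF A FAMILY OF ROWS RECORDS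
# (crux `FluctuationComparisonRegPrIntL`, stmt-QuantumFields-20520, skeleton v5kC (OWNER C3, R-57χ): STUBS 3⁗χ `stub_globalTwoRunSlackFamChi` / (i*)χ `stub_smallBlocksSlackOnChiAllChi`;
# width-lever lane B «(R1) print's χ of [Balaban1985UV3] (47) back», seat ym-ust-19935-r1 g4; core port 3/5)

Lane A's term sizes and size row for `canonPolymer p` / `canonPT p` (`…CanonicalPolymersSizes` p535989, `…TermSize` p537347, `…TermSizeC` p544311; seats ym-ust-19935-slack g0/g2)
stated ONCE over the rows record `q : ∀ K, AlphaInputsT3AC.PkgCoreRows F 𝔠 γ hγ hγ1 K` (objects `canonPolymerRows q` / `canonPTRows q` / `newTermRows q` / `oldTermRows q` of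
`…CanonicalPolymersCore`):

* §1 **`abs_newTermRows_le`** / `abs_newTermRows_le_theta` ((34)/(44) at the birth level from the CORE step rows `chart`, `bound28`, `far_le` and `𝔄.N45`; window
  `cB·r(g_k)g_kp(g_k) ≤ ρ/4`), **`abs_oldTermRows_le`** ((44) ⟹ (45) per block from the CORE step rows `h44`, `hfloor`; window `8L²B₃Z′·g_kp(g_k) ≤ ½`);
* §2 `canonPTRows_new_eq`, `canonPTRows_old_eq` (the filters are singletons), `canonTreeLenRows_blockSet_le` (`≤ L³`, LQB (2.30));
* §3 **`termSizeTrivT_canonRows`** : `TermSizeTrivT (dataOfCoreRows q (canonPolymerRows q)) (canonPTRows q) b₀ p₀ (max newConst (oldConst·L⁴·e^{κ₁L³})) κ₁` for `0 < κ₁ ≤ 𝔠.κ`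
  and the two coupling windows — NO letter on `M₁`.
Proofs VERBATIM with `p ↦ q`, `run.steps ↦ runCore.steps`; the constants `newConst`/`oldConst` and every p-free lemma (`card_mul_cube_le_card_domSet`, `dj_le_of_domSet_eq_blockSet`,
`blockSet_injective`, `domSet_injective`, LQB's `bound45_of_bound44`, `bondSum45_le`, …) are IMPORTED from lane A.  The χ-record's family is the instance `q := toCore ∘ p`,
`p : ∀ K, PkgAtV3Chi`.  Nothing of [Balaban1985UV3] is asserted beyond the core's own rows.

References: T. Bałaban, CMP 102 (1985) 255–275 [Balaban1985UV3] ((7) p.257, (24)–(25) p.262, (28) p.263, (34) p.264, (43)–(46) pp.266–267, (59) p.270); CMP 116 (1988) 1–22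
[Balaban1988RG2Cluster] ((2.30) p.18); CMP 109 (1987) 249–301 [Balaban1987RG1] ((0.1) p.251).
-/

set_option autoImplicit false

noncomputable section

namespace Summit.QuantumFields.YangMills.Theorems.GlobalSlackCanonicalPolymers

open scoped BigOperators
open Finset
open Literature.MathematicalPhysics.QuantumFieldTheory.Balaban1983to89
open Literature.MathematicalPhysics.QuantumFieldTheory.Balaban1983to89.T3ContinuumYM3Torus
open Literature.MathematicalPhysics.QuantumFieldTheory.Balaban1983to89.T3UnitScaleTilt (θBal)
open Literature.MathematicalPhysics.QuantumFieldTheory.Balaban1983to89.T3LevelShift (fieldShift)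
open Literature.MathematicalPhysics.QuantumFieldTheory.Balaban1983to89.T3AlphaInputsAC
open Literature.MathematicalPhysics.QuantumFieldTheory.Balaban1983to89.T3AlphaInputsACTwoRunLevel
open Literature.MathematicalPhysics.QuantumFieldTheory.Balaban1983to89.TreeLengthTorus (tsys TPt torusTreeLen_le_card_sub_one)
open Literature.MathematicalPhysics.QuantumFieldTheory.Balaban1985CMP102
open Literature.MathematicalPhysics.QuantumFieldTheory.Balaban1985CMP102.Setting
open Summit.QuantumFields.Balaban3D.Carriers
open Summit.QuantumFields.Balaban3D.Proofs.Primitives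
open Summit.QuantumFields.Balaban3D.Proofs.Representation33 (jet26)
open Summit.QuantumFields.Balaban3D.Proofs.NewbornJet (tlConst tlConst_nonneg gcube_rsq_psq_le g8_rp7_le abs_re_jet26_le)
open Summit.QuantumFields.Balaban3D.Proofs.ScalesArithmetic (gk_pos gk_le_one)
open Summit.QuantumFields.Balaban3D.Proofs.Bound46Series (bondSum45_le)
open Literature.MathematicalPhysics.QuantumFieldTheory.Balaban1983to89.B10SectCExpansion (Bound44 Bound45 blockSum45 bound45_of_bound44)
open Summit.QuantumFields.YangMills.Theorems

variable {F : T3Family} {𝔠 : AlphaConsts F.L (suGroupModel 2).N} {γ : ℝ} {hγ : 0 < γ} {hγ1 : γ ≤ (min 𝔠.gamma0 1) ^ 2}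

/-! ## §1 The sizes of the new and old terms over the core -/

section Sizes

variable (q : ∀ K, AlphaInputsT3AC.PkgCoreRows F 𝔠 γ hγ hγ1 K)

/-- **THE SIZE OF A NEW TERM OF THE CANONICAL POLYMERISATION OF A FAMILY OF ROWS RECORDS** (lane A's `abs_newTerm_le`, p535989-lineage, over `PkgCoreV3`: rows `chart`/`bound28`/`far_le` of the CORE step record and `𝔄.N45`) ((44)/(34) at the birth level, both displayed chart families): for `k + 1 ≤ K` and the window
`cB·r(g_k)g_kp(g_k) ≤ ρ/4`, `|newTermRows q K k X W| ≤ newConst 𝔠 · (g_kp(g_k))² · e^{−κ·dj X}`. [cite: Balaban1985UV3, (25) p.262, (28) p.263, (34) p.264, (44)-(45) p.267] -/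
theorem abs_newTermRows_le (K k : ℕ) (hk : k + 1 ≤ K)
    (hsmall : 𝔠.cB * (B10.rFun 𝔠.r₀ ((SK F 𝔠 γ hγ hγ1 K).gk k) * (SK F 𝔠 γ hγ hγ1 K).gk k *
        B10.pFun 𝔠.b₀ 𝔠.p₀ ((SK F 𝔠 γ hγ hγ1 K).gk k)) ≤ 𝔠.ρ / 4)
    (X : (tsys 3 (nblkOf (SK F 𝔠 γ hγ hγ1 K) 𝔠.lane.carrier k)).Dom) (W : GaugeField (F.P K) (k + 1) (Matrix.specialUnitaryGroup (Fin 2) ℂ)) :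
    |newTermRows q K k X W| ≤ newConst 𝔠 * ((SK F 𝔠 γ hγ hγ1 K).gk k * B10.pFun 𝔠.b₀ 𝔠.p₀ ((SK F 𝔠 γ hγ hγ1 K).gk k)) ^ 2 *
      Real.exp (-(𝔠.κ * (tsys 3 (nblkOf (SK F 𝔠 γ hγ hγ1 K) 𝔠.lane.carrier k)).dj X)) := by
  -- letters
  set g : ℝ := (SK F 𝔠 γ hγ hγ1 K).gk k with hgdef
  set pg : ℝ := B10.pFun 𝔠.b₀ 𝔠.p₀ g with hpgdef
  set r : ℝ := B10.rFun 𝔠.r₀ g with hrdef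
  set e : ℝ := Real.exp (-(𝔠.κ * (tsys 3 (nblkOf (SK F 𝔠 γ hγ hγ1 K) 𝔠.lane.carrier k)).dj X)) with hedef
  have hg0 : 0 < g := gk_pos _ k
  have hg1 : g ≤ 1 := gk_le_one _ (SK F 𝔠 γ hγ hγ1 K).gK_le_one k (by show k ≤ K; omega)
  have hpg0 : 0 ≤ pg := B10.pFun_nonneg _ _ _ 𝔠.b₀_pos.le hg0 hg1
  have hr0 : 0 ≤ r := by rw [hrdef]; unfold B10.rFun; exact Real.rpow_nonneg (by linarith [B10.log_inv_nonneg_of_le_one hg0 hg1]) _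
  have he0 : 0 ≤ e := (Real.exp_pos _).le
  have hρ : 0 < 𝔠.ρ := 𝔠.ρ_pos
  have hs0 : 0 ≤ 𝔠.cB * (r * g * pg) := mul_nonneg 𝔠.cB_nonneg (by positivity)
  -- the displayed rows
  have hstep := (q K).runRows.steps k hk
  obtain ⟨hρ', hdiff, hM⟩ := hstep.chart X
  have hB := hstep.bound28 X (Hist.triv (F.P K) (k + 1)) W
  -- (a) the jet of the step chart is second order
  have hjet : |(jet26 (((q K).𝔖 k).Ψ X) (((q K).𝔖 k).Bcfg X (Hist.triv (F.P K) (k + 1)) W)).re| ≤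
      5 * (𝔠.C25 * g * e) * (2 * (𝔠.cB * (r * g * pg)) / 𝔠.ρ) ^ 2 :=
    abs_re_jet26_le hρ' hdiff hM hs0 hsmall hB
  -- (b) the far terms
  have hfar : |((q K).𝔖 k).far X (Hist.triv (F.P K) (k + 1)) W| ≤ 𝔠.Cfar * ((𝔠.C25 * g * e) * (g ^ 7 * (r * pg) ^ 7)) :=
    hstep.far_le X (Hist.triv (F.P K) (k + 1)) W
  -- (c) the (61)-born piece (G3D-08)
  have hΛ : |(jet26 (((q K).𝔄.Λc k).Ψ X) (((q K).𝔖 k).Bcfg X (Hist.triv (F.P K) (k + 1)) W)).re -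
      ((q K).𝔄.Λc k).far X (Hist.triv (F.P K) (k + 1)) W| ≤ 𝔠.C45 * (g * pg) ^ 2 * (𝔠.C63 * e) :=
    ((q K).𝔄.N45 k).jet45 X (Hist.triv (F.P K) (k + 1)) W
  -- absorb the polylogarithms
  have hA : g ^ 3 * r ^ 2 * pg ^ 2 ≤ tlConst (2 * 𝔠.r₀) 1 * (g ^ 2 * pg ^ 2) :=
    gcube_rsq_psq_le 𝔠.r₀ 𝔠.b₀ 𝔠.p₀ g (by linarith [𝔠.one_le_r₀]) hg0 hg1
  have hBfar : g ^ 8 * (r * pg) ^ 7 ≤ 𝔠.b₀ ^ 5 * tlConst (7 * 𝔠.r₀ + 5 * 𝔠.p₀) 6 * (g ^ 2 * pg ^ 2) :=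
    g8_rp7_le 𝔠.r₀ 𝔠.b₀ 𝔠.p₀ g (by linarith [𝔠.one_le_r₀, 𝔠.p₀_pos]) 𝔠.b₀_pos.le hg0 hg1
  -- rewrite the three bounds in the common currency `(g pg)² e`
  have ha' : 5 * (𝔠.C25 * g * e) * (2 * (𝔠.cB * (r * g * pg)) / 𝔠.ρ) ^ 2 ≤
      (20 * 𝔠.C25 * 𝔠.cB ^ 2 / 𝔠.ρ ^ 2 * tlConst (2 * 𝔠.r₀) 1) * ((g * pg) ^ 2 * e) := by
    have heq : 5 * (𝔠.C25 * g * e) * (2 * (𝔠.cB * (r * g * pg)) / 𝔠.ρ) ^ 2 =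
        (20 * 𝔠.C25 * 𝔠.cB ^ 2 / 𝔠.ρ ^ 2) * e * (g ^ 3 * r ^ 2 * pg ^ 2) := by
      field_simp
      ring
    rw [heq]
    have hc : 0 ≤ (20 * 𝔠.C25 * 𝔠.cB ^ 2 / 𝔠.ρ ^ 2) * e := by have := 𝔠.C25_nonneg; have := 𝔠.cB_nonneg; positivity
    calc (20 * 𝔠.C25 * 𝔠.cB ^ 2 / 𝔠.ρ ^ 2) * e * (g ^ 3 * r ^ 2 * pg ^ 2)
        ≤ (20 * 𝔠.C25 * 𝔠.cB ^ 2 / 𝔠.ρ ^ 2) * e * (tlConst (2 * 𝔠.r₀) 1 * (g ^ 2 * pg ^ 2)) := mul_le_mul_of_nonneg_left hA hc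
      _ = _ := by ring
  have hb' : 𝔠.Cfar * ((𝔠.C25 * g * e) * (g ^ 7 * (r * pg) ^ 7)) ≤
      (𝔠.Cfar * 𝔠.C25 * 𝔠.b₀ ^ 5 * tlConst (7 * 𝔠.r₀ + 5 * 𝔠.p₀) 6) * ((g * pg) ^ 2 * e) := by
    have heq : 𝔠.Cfar * ((𝔠.C25 * g * e) * (g ^ 7 * (r * pg) ^ 7)) = (𝔠.Cfar * 𝔠.C25 * e) * (g ^ 8 * (r * pg) ^ 7) := by ring
    rw [heq]
    have hc : 0 ≤ 𝔠.Cfar * 𝔠.C25 * e := by have := 𝔠.C25_nonneg; have := 𝔠.Cfar_nonneg; positivity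
    calc (𝔠.Cfar * 𝔠.C25 * e) * (g ^ 8 * (r * pg) ^ 7)
        ≤ (𝔠.Cfar * 𝔠.C25 * e) * (𝔠.b₀ ^ 5 * tlConst (7 * 𝔠.r₀ + 5 * 𝔠.p₀) 6 * (g ^ 2 * pg ^ 2)) := mul_le_mul_of_nonneg_left hBfar hc
      _ = _ := by ring
  have hc' : 𝔠.C45 * (g * pg) ^ 2 * (𝔠.C63 * e) = (𝔠.C45 * 𝔠.C63) * ((g * pg) ^ 2 * e) := by ring
  -- assemble
  have hsplit : newTermRows q K k X W =
      ((jet26 (((q K).𝔖 k).Ψ X) (((q K).𝔖 k).Bcfg X (Hist.triv (F.P K) (k + 1)) W)).re -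
        ((q K).𝔖 k).far X (Hist.triv (F.P K) (k + 1)) W) +
      ((jet26 (((q K).𝔄.Λc k).Ψ X) (((q K).𝔖 k).Bcfg X (Hist.triv (F.P K) (k + 1)) W)).re -
        ((q K).𝔄.Λc k).far X (Hist.triv (F.P K) (k + 1)) W) := rfl
  rw [hsplit]
  calc |_ + _| ≤ |(jet26 (((q K).𝔖 k).Ψ X) (((q K).𝔖 k).Bcfg X (Hist.triv (F.P K) (k + 1)) W)).re -
          ((q K).𝔖 k).far X (Hist.triv (F.P K) (k + 1)) W| + _ := abs_add_le _ _
    _ ≤ (|(jet26 (((q K).𝔖 k).Ψ X) (((q K).𝔖 k).Bcfg X (Hist.triv (F.P K) (k + 1)) W)).re| +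
          |((q K).𝔖 k).far X (Hist.triv (F.P K) (k + 1)) W|) + 𝔠.C45 * (g * pg) ^ 2 * (𝔠.C63 * e) :=
        add_le_add (abs_sub _ _) hΛ
    _ ≤ ((20 * 𝔠.C25 * 𝔠.cB ^ 2 / 𝔠.ρ ^ 2 * tlConst (2 * 𝔠.r₀) 1) * ((g * pg) ^ 2 * e) +
          (𝔠.Cfar * 𝔠.C25 * 𝔠.b₀ ^ 5 * tlConst (7 * 𝔠.r₀ + 5 * 𝔠.p₀) 6) * ((g * pg) ^ 2 * e)) +
          (𝔠.C45 * 𝔠.C63) * ((g * pg) ^ 2 * e) := by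
        rw [← hc']
        exact add_le_add (add_le_add (hjet.trans ha') (hfar.trans hb')) le_rfl
    _ = newConst 𝔠 * (g * pg) ^ 2 * e := by unfold newConst; ring

/-- **THE SAME IN THE INTERFACE'S WINDOW LETTER**: `(g_kp(g_k))² = θBal F.L γ b₀ p₀ (K − k)²` (`PkgCoreV3.eps1_eq`), so for `k + 1 ≤ K`,
`|newTermRows q K k X W| ≤ newConst 𝔠 · θ(K − k)² · e^{−κ·dj X}`. [cite: Balaban1985UV3, (7) p.257, (44) p.267] -/
theorem abs_newTermRows_le_theta (K k : ℕ) (hk : k + 1 ≤ K)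
    (hsmall : 𝔠.cB * (B10.rFun 𝔠.r₀ ((SK F 𝔠 γ hγ hγ1 K).gk k) * (SK F 𝔠 γ hγ hγ1 K).gk k *
        B10.pFun 𝔠.b₀ 𝔠.p₀ ((SK F 𝔠 γ hγ hγ1 K).gk k)) ≤ 𝔠.ρ / 4)
    (X : (tsys 3 (nblkOf (SK F 𝔠 γ hγ hγ1 K) 𝔠.lane.carrier k)).Dom) (W : GaugeField (F.P K) (k + 1) (Matrix.specialUnitaryGroup (Fin 2) ℂ)) :
    |newTermRows q K k X W| ≤ newConst 𝔠 * θBal F.L γ 𝔠.b₀ 𝔠.p₀ (K - k) ^ 2 *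
      Real.exp (-(𝔠.κ * (tsys 3 (nblkOf (SK F 𝔠 γ hγ hγ1 K) 𝔠.lane.carrier k)).dj X)) := by
  have heps : (SK F 𝔠 γ hγ hγ1 K).gk k * B10.pFun 𝔠.b₀ 𝔠.p₀ ((SK F 𝔠 γ hγ hγ1 K).gk k) = θBal F.L γ 𝔠.b₀ 𝔠.p₀ (K - k) :=
    (q K).eps1_eq k (by omega)
  rw [← heps]
  exact abs_newTermRows_le q K k hk hsmall X W

/-- **THE SIZE OF AN OLD TERM OF THE CANONICAL POLYMERISATION OF A FAMILY OF ROWS RECORDS, PER BLOCK** (lane A's `abs_oldTerm_le` over `PkgCoreV3`: rows `h44`/`hfloor` of the CORE step record) ((44) ⟹ (45) p.267 «summation over all Y_j with y fixed yields …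
≤ O(1)(O(M₁³)g p(g))²(Lʲη)⁴»): for `k + 1 ≤ K`, `i ∈ [1, k]`, the window `8L²B₃Z′·g_kp(g_k) ≤ ½` and any level-`i` block `y`,
`|oldTermRows q K k i y W| ≤ oldConst 𝔠 · (g_kp(g_k))² · ℓ_i⁴`, `ℓ_i = L^{−(k−i)}` — from the displayed rows `h44` ((44)) and `hfloor` (degree ≥ 2) through LQB's
`bound45_of_bound44` and the torus bond sum `bondSum45_le` (nothing is dropped at the trivial history). [cite: Balaban1985UV3, (44)-(45) p.267] -/
theorem abs_oldTermRows_le (K k : ℕ) (hk : k + 1 ≤ K) (i : ℕ) (hi : i ∈ Finset.Icc 1 k)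
    (hsmall : 8 * (F.L : ℝ) ^ 2 * 𝔠.B₃ * 𝔠.Zfull * ((SK F 𝔠 γ hγ hγ1 K).gk k * B10.pFun 𝔠.b₀ 𝔠.p₀ ((SK F 𝔠 γ hγ hγ1 K).gk k)) ≤ 1 / 2)
    (y : Site (F.P K) i) (W : GaugeField (F.P K) (k + 1) (Matrix.specialUnitaryGroup (Fin 2) ℂ)) :
    |oldTermRows q K k i y W| ≤ oldConst 𝔠 * ((SK F 𝔠 γ hγ hγ1 K).gk k * B10.pFun 𝔠.b₀ 𝔠.p₀ ((SK F 𝔠 γ hγ hγ1 K).gk k)) ^ 2 *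
      ell (F.P K) k i ^ 4 := by
  classical
  set g : ℝ := (SK F 𝔠 γ hγ hγ1 K).gk k with hgdef
  set pg : ℝ := B10.pFun 𝔠.b₀ 𝔠.p₀ g with hpgdef
  have hg0 : 0 < g := gk_pos _ k
  have hg1 : g ≤ 1 := gk_le_one _ (SK F 𝔠 γ hγ hγ1 K).gK_le_one k (by show k ≤ K; omega)
  have hpg0 : 0 ≤ pg := B10.pFun_nonneg _ _ _ 𝔠.b₀_pos.le hg0 hg1
  have hM : 0 < 𝔠.M₁ := 𝔠.M₁_pos
  have hstep := (q K).runRows.steps k hk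
  -- the value model at the trivial history: nothing is dropped
  let PU : (j : ℕ) → Site (F.P K) j → (n : ℕ) → (Fin n → PBond (F.P K) j) → ℝ :=
    fun j y n c => ((q K).𝔖 k).oldVal (Hist.triv (F.P K) (k + 1)) W j y n c
  have hterm : oldTermRows q K k i y W = ∑ n ∈ range (((q K).𝔖 k).Ndeg i + 1),
      ∑ c ∈ Fintype.piFinset (fun _ : Fin n => oldBonds 𝔠.lane.carrier.M₁ (rcolOf (SK F 𝔠 γ hγ hγ1 K) 𝔠.lane.carrier) (Hist.triv (F.P K) (k + 1)) i y),
        PU i y n c := by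
    unfold oldTermRows
    refine Finset.sum_congr rfl fun n _ => Finset.sum_congr rfl fun c _ => ?_
    rw [if_neg (not_drop_triv 𝔠.lane.carrier.M₁ (rcolOf (SK F 𝔠 γ hγ hγ1 K) 𝔠.lane.carrier) i y n c)]
  -- (45) per block from (44), degree floor and the torus bond sum
  have h45 : Bound45 (oldGeom (F.P K) k i)
      (blockSum45 (oldGeom (F.P K) k i) (PU i)
        (fun y => oldBonds 𝔠.lane.carrier.M₁ (rcolOf (SK F 𝔠 γ hγ hγ1 K) 𝔠.lane.carrier) (Hist.triv (F.P K) (k + 1)) i y) (((q K).𝔖 k).Ndeg i))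
      (8 * (F.L : ℝ) ^ 2 * 𝔠.B₃ * 𝔠.Zfull) g pg (ell (F.P K) k i) (2 * 𝔠.C44) := by
    refine bound45_of_bound44 (oldGeom (F.P K) k i) (PU i) _ _ (κ₁ := 𝔠.κ₁) (M₁ := (𝔠.M₁ : ℝ)) 𝔠.C44_nonneg (ell_pos (F.P K) k i)
      𝔠.B₃_pos.le hg0.le hpg0 (oldGeom_dist_nonneg (F.P K) k i) (hstep.h44 (Hist.triv (F.P K) (k + 1)) W i hi)
      (hstep.hfloor (Hist.triv (F.P K) (k + 1)) W i hi) (fun y₀ => bondSum45_le (S := SK F 𝔠 γ hγ hγ1 K) hM 𝔠.κ₁_pos k i _ y₀) ?_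
    have hℓ1 : ell (F.P K) k i ^ 2 ≤ 1 := by
      have hle : ell (F.P K) k i ≤ 1 := by
        unfold ell
        exact pow_le_one₀ (inv_nonneg.mpr (by exact_mod_cast (F.P K).L_pos.le))
          (inv_le_one_of_one_le₀ (by exact_mod_cast F.hL.2.le))
      exact pow_le_one₀ (ell_pos (F.P K) k i).le hle
    have h0 : 0 ≤ 8 * (F.L : ℝ) ^ 2 * 𝔠.B₃ * 𝔠.Zfull * g * pg := by
      have := 𝔠.B₃_pos; have := 𝔠.Zfull_pos; positivity
    calc 8 * (F.L : ℝ) ^ 2 * 𝔠.B₃ * 𝔠.Zfull * g * pg * ell (F.P K) k i ^ 2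
        ≤ 8 * (F.L : ℝ) ^ 2 * 𝔠.B₃ * 𝔠.Zfull * g * pg * 1 := mul_le_mul_of_nonneg_left hℓ1 h0
      _ ≤ 1 / 2 := by rw [mul_one]; simpa only [mul_assoc] using hsmall
  -- the signed sum is dominated by the block sum of absolute values
  have htri : |oldTermRows q K k i y W| ≤ blockSum45 (oldGeom (F.P K) k i) (PU i)
      (fun y => oldBonds 𝔠.lane.carrier.M₁ (rcolOf (SK F 𝔠 γ hγ hγ1 K) 𝔠.lane.carrier) (Hist.triv (F.P K) (k + 1)) i y) (((q K).𝔖 k).Ndeg i) y := by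
    rw [hterm]
    unfold blockSum45
    refine (Finset.abs_sum_le_sum_abs _ _).trans (Finset.sum_le_sum fun n _ => ?_)
    exact Finset.abs_sum_le_sum_abs _ _
  refine htri.trans ((h45 y).trans (le_of_eq ?_))
  unfold oldConst
  ring

end Sizes

/-! ## §2 The filters defining `canonPTRows` are singletons; a block domain's core tree length is at most `L³` -/

open Classical in
/-- At a retained domain the canonical new term IS `newTermRows` of that domain. [cite: Balaban1985UV3, (43) p.266] -/
theorem canonPTRows_new_eq (q : ∀ K, AlphaInputsT3AC.PkgCoreRows F 𝔠 γ hγ hγ1 K) (K k : ℕ) (hk : k + 1 ≤ K)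
    (X : (tsys 3 (nblkOf (SK F 𝔠 γ hγ hγ1 K) 𝔠.lane.carrier k)).Dom) (hX : X ∈ newDomsRows q K k (Hist.triv (F.P K) (k + 1)))
    (W : GaugeField (F.P K) (k + 1) (Matrix.specialUnitaryGroup (Fin 2) ℂ)) :
    canonPTRows q K (k + 1) (k + 1) (domSet (F := F) 𝔠.lane.carrier.M₁ K k X) W = newTermRows q K k X W := by
  have hkm : k ≤ F.m + K := by have := F.hm; omega
  have hfil : (newDomsRows q K k (Hist.triv (F.P K) (k + 1))).filter
      (fun X' => domSet (F := F) 𝔠.lane.carrier.M₁ K k X' = domSet (F := F) 𝔠.lane.carrier.M₁ K k X) = {X} := by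
    ext X'
    simp only [mem_filter, mem_singleton]
    exact ⟨fun h => domSet_injective K k hkm h.2, fun h => by subst h; exact ⟨hX, rfl⟩⟩
  simp only [canonPTRows, if_pos hk, ite_true]
  rw [hfil, sum_singleton]

open Classical in
/-- At a block the canonical old term IS `oldTermRows` of that block. [cite: Balaban1985UV3, (43) p.266] -/
theorem canonPTRows_old_eq (q : ∀ K, AlphaInputsT3AC.PkgCoreRows F 𝔠 γ hγ hγ1 K) (K k : ℕ) (hk : k + 1 ≤ K) (i : ℕ) (hi : i ∈ Finset.Icc 1 k)
    (y : Site (F.P K) i)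
    (hy : y ∈ oldBlocks 𝔠.lane.carrier.M₁ (rcolOf (SK F 𝔠 γ hγ hγ1 K) 𝔠.lane.carrier) (Hist.triv (F.P K) (k + 1)) i)
    (W : GaugeField (F.P K) (k + 1) (Matrix.specialUnitaryGroup (Fin 2) ℂ)) :
    canonPTRows q K (k + 1) i (blockSet K i y) W = oldTermRows q K k i y W := by
  have hik : i ≠ k + 1 := by have := (Finset.mem_Icc.mp hi).2; omega
  have him : i ≤ F.m + K := by have := (Finset.mem_Icc.mp hi).2; have := F.hm; omega
  have hfil : (oldBlocks 𝔠.lane.carrier.M₁ (rcolOf (SK F 𝔠 γ hγ hγ1 K) 𝔠.lane.carrier) (Hist.triv (F.P K) (k + 1)) i).filter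
      (fun y' => blockSet K i y' = blockSet K i y) = {y} := by
    ext y'
    simp only [mem_filter, mem_singleton]
    exact ⟨fun h => blockSet_injective K i him h.2, fun h => by subst h; exact ⟨hy, rfl⟩⟩
  simp only [canonPTRows, if_pos hk, if_neg hik]
  rw [hfil, sum_singleton]


/-- **THE CANONICAL TREE LENGTH OF A BLOCK DOMAIN IS AT MOST `L³`** (`1 ≤ i ≤ m + K`, no condition on `M₁`; with `L ≤ M₁` it is `0`, g0's `canonTreeLen_blockSet`).
[cite: Balaban1985UV3, (24)-(25) p.262] -/
theorem canonTreeLenRows_blockSet_le (q : ∀ K, AlphaInputsT3AC.PkgCoreRows F 𝔠 γ hγ hγ1 K) (K i : ℕ) (hi1 : 1 ≤ i) (hi : i ≤ F.m + K)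
    (y : Site (F.P K) i) : canonTreeLenRows q K i (blockSet K i y) ≤ (F.L : ℝ) ^ 3 := by
  obtain ⟨k, rfl⟩ : ∃ k, i = k + 1 := ⟨i - 1, by omega⟩
  unfold canonTreeLenRows
  set S := (fun X => (tsys 3 ((q K).𝔖 (k + 1 - 1)).Nblk).dj X) ''
      {X : (tsys 3 ((q K).𝔖 (k + 1 - 1)).Nblk).Dom | domSet (F := F) 𝔠.lane.carrier.M₁ K (k + 1 - 1) X = blockSet K (k + 1) y} with hS
  have hL3 : (0 : ℝ) ≤ (F.L : ℝ) ^ 3 := by positivity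
  rcases S.eq_empty_or_nonempty with hE | ⟨t, X, hX, rfl⟩
  · rw [hE, Real.sInf_empty]; exact hL3
  · have hbdd : BddBelow S := ⟨0, by rintro s ⟨X', -, rfl⟩; exact (tsys 3 _).dj_nonneg X'⟩
    refine (csInf_le hbdd ⟨X, hX, rfl⟩).trans ?_
    exact dj_le_of_domSet_eq_blockSet (γ := γ) (hγ := hγ) (hγ1 := hγ1) K k hi X y hX


/-! ## §3 The size row over the core, no letter on `M₁` -/

/-- **`TermSizeTrivT` FOR THE CANONICAL POLYMERISATION OF EVERY FAMILY OF ROWS RECORDS, NO CONDITION ON `M₁`** (lane A's `termSizeTrivT_canon'`, p544311, over `PkgCoreV3`): for `0 < κ₁ ≤ 𝔠.κ` and the two coupling windows of `…Sizes`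
(`cB·r(g_k)g_kp(g_k) ≤ ρ/4` and `8L²B₃Z′·g_kp(g_k) ≤ ½` at every step `k < K` of every run), the canonical term function obeys print's (44) at the trivial history
with constant `max (newConst 𝔠) (oldConst 𝔠·L⁴·e^{κ₁L³})` — the block tree length bounded by `L³`.  The producer's FIFTH row, discharged for every constants record and every family of rows records. [cite: Balaban1985UV3, (44)-(45) p.267, (34) p.264] -/
theorem termSizeTrivT_canonRows (q : ∀ K, AlphaInputsT3AC.PkgCoreRows F 𝔠 γ hγ hγ1 K) {κ₁ : ℝ} (hκ₁ : 0 < κ₁) (hκle : κ₁ ≤ 𝔠.κ)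
    (hw1 : ∀ K k, k + 1 ≤ K → 𝔠.cB * (B10.rFun 𝔠.r₀ ((SK F 𝔠 γ hγ hγ1 K).gk k) * (SK F 𝔠 γ hγ hγ1 K).gk k *
        B10.pFun 𝔠.b₀ 𝔠.p₀ ((SK F 𝔠 γ hγ hγ1 K).gk k)) ≤ 𝔠.ρ / 4)
    (hw2 : ∀ K k, k + 1 ≤ K → 8 * (F.L : ℝ) ^ 2 * 𝔠.B₃ * 𝔠.Zfull *
        ((SK F 𝔠 γ hγ hγ1 K).gk k * B10.pFun 𝔠.b₀ 𝔠.p₀ ((SK F 𝔠 γ hγ hγ1 K).gk k)) ≤ 1 / 2) :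
    TermSizeTrivT (AlphaInputsT3AC.dataOfCoreRows q (canonPolymerRows q)) (canonPTRows q) 𝔠.b₀ 𝔠.p₀
      (max (newConst 𝔠) (oldConst 𝔠 * (F.L : ℝ) ^ 4 * Real.exp (κ₁ * (F.L : ℝ) ^ 3))) κ₁ := by
  classical
  refine ⟨hκ₁, fun K n hn V hV i hi1 hi2 Y hY => ?_⟩
  change Y ∈ canonLocRows q K (K - n) (Hist.triv (F.P K) (K - n)) i at hY
  change |canonPTRows q K (K - n) i Y _| ≤ max (newConst 𝔠) (oldConst 𝔠 * (F.L : ℝ) ^ 4 * Real.exp (κ₁ * (F.L : ℝ) ^ 3)) *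
    Real.exp (-κ₁ * canonTreeLenRows q K i Y) * θBal F.L γ 𝔠.b₀ 𝔠.p₀ (n + 1) ^ 2 * (((F.L : ℝ) ^ (K - n - i))⁻¹) ^ 4
  -- name the lattice level `K − n = k + 1`
  suffices hW : ∀ W : GaugeField (F.P K) (K - n) (Matrix.specialUnitaryGroup (Fin 2) ℂ), |canonPTRows q K (K - n) i Y W| ≤
      max (newConst 𝔠) (oldConst 𝔠 * (F.L : ℝ) ^ 4 * Real.exp (κ₁ * (F.L : ℝ) ^ 3)) * Real.exp (-κ₁ * canonTreeLenRows q K i Y) *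
        θBal F.L γ 𝔠.b₀ 𝔠.p₀ (n + 1) ^ 2 * (((F.L : ℝ) ^ (K - n - i))⁻¹) ^ 4 from hW _
  obtain ⟨k, hk⟩ : ∃ k, K - n = k + 1 := ⟨K - n - 1, by omega⟩
  rw [hk] at hY
  rw [hk]
  intro W
  have hkK : k + 1 ≤ K := by omega
  have hKk : K - k = n + 1 := by omega
  have hkm : k ≤ F.m + K := by have := F.hm; omega
  have hL1 : (1 : ℝ) ≤ F.L := by exact_mod_cast F.hL.2.le
  have hL0 : (0 : ℝ) < F.L := by linarith
  have hθ2 : 0 ≤ θBal F.L γ 𝔠.b₀ 𝔠.p₀ (n + 1) ^ 2 := sq_nonneg _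
  have hmax0 : 0 ≤ max (newConst 𝔠) (oldConst 𝔠 * (F.L : ℝ) ^ 4 * Real.exp (κ₁ * (F.L : ℝ) ^ 3)) :=
    le_max_of_le_left (newConst_nonneg 𝔠)
  by_cases hik : i = k + 1
  · -- NEW term of a retained domain
    subst hik
    simp only [canonLocRows, if_pos hkK, ite_true, mem_image] at hY
    obtain ⟨X, hX, rfl⟩ := hY
    rw [canonPTRows_new_eq q K k hkK X hX W, canonTreeLenRows_domSet q K k hkm X]
    have hb := abs_newTermRows_le_theta q K k hkK (hw1 K k hkK) X W
    rw [hKk] at hb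
    refine hb.trans ?_
    have hx : (((F.L : ℝ) ^ (k + 1 - (k + 1)))⁻¹) ^ 4 = 1 := by simp
    rw [hx, mul_one]
    have hexp : Real.exp (-(𝔠.κ * (tsys 3 (nblkOf (SK F 𝔠 γ hγ hγ1 K) 𝔠.lane.carrier k)).dj X)) ≤
        Real.exp (-κ₁ * (tsys 3 (nblkOf (SK F 𝔠 γ hγ hγ1 K) 𝔠.lane.carrier k)).dj X) := by
      rw [Real.exp_le_exp]
      have := (tsys 3 (nblkOf (SK F 𝔠 γ hγ hγ1 K) 𝔠.lane.carrier k)).dj_nonneg X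
      nlinarith
    calc newConst 𝔠 * θBal F.L γ 𝔠.b₀ 𝔠.p₀ (n + 1) ^ 2 * Real.exp (-(𝔠.κ * (tsys 3 _).dj X))
        ≤ max (newConst 𝔠) (oldConst 𝔠 * (F.L : ℝ) ^ 4 * Real.exp (κ₁ * (F.L : ℝ) ^ 3)) * θBal F.L γ 𝔠.b₀ 𝔠.p₀ (n + 1) ^ 2 *
            Real.exp (-κ₁ * (tsys 3 _).dj X) :=
          mul_le_mul (mul_le_mul_of_nonneg_right (le_max_left _ _) hθ2) hexp (Real.exp_pos _).le (mul_nonneg hmax0 hθ2)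
      _ = _ := by ring
  · by_cases hi : i ∈ Finset.Icc 1 k
    · -- OLD term of a block: tree length `≤ L³`, paid by `e^{κ₁L³}` in the constant
      simp only [canonLocRows, if_pos hkK, if_neg hik, if_pos hi, mem_image] at hY
      obtain ⟨y, hy, rfl⟩ := hY
      have him : i ≤ F.m + K := by have := (Finset.mem_Icc.mp hi).2; omega
      rw [canonPTRows_old_eq q K k hkK i hi y hy W]
      have htl := canonTreeLenRows_blockSet_le q K i hi1 him y
      have hb := abs_oldTermRows_le q K k hkK i hi (hw2 K k hkK) y W
      have heps : (SK F 𝔠 γ hγ hγ1 K).gk k * B10.pFun 𝔠.b₀ 𝔠.p₀ ((SK F 𝔠 γ hγ hγ1 K).gk k) = θBal F.L γ 𝔠.b₀ 𝔠.p₀ (K - k) :=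
        (q K).eps1_eq k (by omega)
      rw [heps, hKk] at hb
      refine hb.trans ?_
      -- `ℓ_i⁴ = L⁴ · (L^{k+1−i})⁻⁴`
      have hik' : i ≤ k := (Finset.mem_Icc.mp hi).2
      have hell : ell (F.P K) k i ^ 4 = (F.L : ℝ) ^ 4 * (((F.L : ℝ) ^ (k + 1 - i))⁻¹) ^ 4 := by
        have e1 : ell (F.P K) k i = ((F.L : ℝ)⁻¹) ^ (k - i) := rfl
        have hL4 : ((F.L : ℝ) * (F.L : ℝ)⁻¹) ^ 4 = 1 := by rw [mul_inv_cancel₀ hL0.ne', one_pow]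
        rw [e1, show k + 1 - i = (k - i) + 1 by omega, pow_succ (F.L : ℝ) (k - i), mul_inv, mul_pow, ← inv_pow (F.L : ℝ) (k - i)]
        calc ((F.L : ℝ)⁻¹ ^ (k - i)) ^ 4 = ((F.L : ℝ)⁻¹ ^ (k - i)) ^ 4 * ((F.L : ℝ) * (F.L : ℝ)⁻¹) ^ 4 := by rw [hL4, mul_one]
          _ = _ := by ring
      rw [hell]
      have hE : 1 ≤ Real.exp (κ₁ * (F.L : ℝ) ^ 3) * Real.exp (-κ₁ * canonTreeLenRows q K i (blockSet K i y)) := by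
        rw [← Real.exp_add]
        refine Real.one_le_exp ?_
        nlinarith
      have hO : 0 ≤ oldConst 𝔠 * (F.L : ℝ) ^ 4 := mul_nonneg (oldConst_nonneg 𝔠) (by positivity)
      have hx4 : 0 ≤ (((F.L : ℝ) ^ (k + 1 - i))⁻¹) ^ 4 := by positivity
      calc oldConst 𝔠 * θBal F.L γ 𝔠.b₀ 𝔠.p₀ (n + 1) ^ 2 * ((F.L : ℝ) ^ 4 * (((F.L : ℝ) ^ (k + 1 - i))⁻¹) ^ 4)
          = (oldConst 𝔠 * (F.L : ℝ) ^ 4) * 1 * (θBal F.L γ 𝔠.b₀ 𝔠.p₀ (n + 1) ^ 2 * (((F.L : ℝ) ^ (k + 1 - i))⁻¹) ^ 4) := by ring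
        _ ≤ (oldConst 𝔠 * (F.L : ℝ) ^ 4) *
              (Real.exp (κ₁ * (F.L : ℝ) ^ 3) * Real.exp (-κ₁ * canonTreeLenRows q K i (blockSet K i y))) *
              (θBal F.L γ 𝔠.b₀ 𝔠.p₀ (n + 1) ^ 2 * (((F.L : ℝ) ^ (k + 1 - i))⁻¹) ^ 4) :=
            mul_le_mul_of_nonneg_right (mul_le_mul_of_nonneg_left hE hO) (mul_nonneg hθ2 hx4)
        _ = (oldConst 𝔠 * (F.L : ℝ) ^ 4 * Real.exp (κ₁ * (F.L : ℝ) ^ 3)) * Real.exp (-κ₁ * canonTreeLenRows q K i (blockSet K i y)) *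
              θBal F.L γ 𝔠.b₀ 𝔠.p₀ (n + 1) ^ 2 * (((F.L : ℝ) ^ (k + 1 - i))⁻¹) ^ 4 := by ring
        _ ≤ _ := mul_le_mul_of_nonneg_right (mul_le_mul_of_nonneg_right
              (mul_le_mul_of_nonneg_right (le_max_right _ _) (Real.exp_pos _).le) hθ2) hx4
    · simp only [canonLocRows, if_pos hkK, if_neg hik, if_neg hi] at hY
      simp at hY

end Summit.QuantumFields.YangMills.Theorems.GlobalSlackCanonicalPolymers

end
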